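import Literature.NumberTheory.EllipticCurves.TianYuanZhang2017.UPlusOfGenusPointData
import Literature.NumberTheory.EllipticCurves.MordellWeilRankZeroProofs
import HarnessLib

/-!
# Tian–Yuan–Zhang, W2 without Gross–Zagier–Kolyvagin: U⁺ from the displayed §3 statements and `rank E_n(ℚ) ≤ 1`,
# and «`rank E_n(ℚ) = 0` ⟹ the genus sums are EVEN»

PROOFS ONLY (no definition, no named fact, nothing asserted; cell `bsd-print-cf2`, prover p2 — the
`2`-descent-matrix road).  The tree's `W2.uPlus_genusField_of` (file `UPlusOfGenusPointData.lean`, cell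
`bsd-monsky` / sub-lane «bsd-p2») derives Tian–Yuan–Zhang's `ρ`-free parity statement U⁺ from the displayed §3
data `tyz_genusPointData` AND Gross–Zagier–Kolyvagin (`rank_eq_analyticRank_of_analyticRank_le_one`), the
latter being used at exactly ONE point: to turn `ord_{s=1} L(E_n, s) ≤ 1` into `rank E_n(ℚ) ≤ 1`, so that
`E_n(ℚ)` and `A_n(ℚ)` are cyclic modulo torsion and Thm. 3.5's generator `α_n` exists.  For the congruent-number
curves the bound `rank E_n(ℚ) ≤ 1` is supplied WITHOUT any `L`-function by `2`-descent whenever Monsky's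
`s(n) = 1` (`#Sel⁽²⁾(E_n/ℚ) = 8`, the tree's Monsky matrices with equality).  This file therefore re-runs the W2
proof with the rank bound as a HYPOTHESIS:

* `uPlus_genusField_of_mordellWeilRank_le_one` — U⁺ for ONE square-free `n ≡ 5, 6, 7 (mod 8)` with
  `rank E_n(ℚ) ≤ 1`, modulo `tyz_genusPointData` ALONE (no GZK): there is an integer `L` with `IsScriptL n L`
  such that `2 ∣ L` forces the genus sums of the class to be even;
* `even_genusSums_of_mordellWeilRank_eq_zero` — for square-free `n ≡ 5, 6, 7 (mod 8)` with `rank E_n(ℚ) = 0`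
  the genus sums of the class ARE even, modulo `tyz_genusPointData` alone.  Mechanism: with `E_n(ℚ)` finite,
  `A_n(ℚ)` is finite (isogeny), the generator `α_n` of Thm. 3.5 may be taken to be `0`, so the displayed main
  clause «`2^{1+ρ}P(n) − s𝓛(n)α_n` is torsion» (or, if `𝓛(n) = 0`, «`P(n)` is torsion») makes the genus
  point `P(n)` TORSION; then the proof of Thm. 3.5 (2) runs with the `E`-side relation `2φ(P(n)) ∈ E_tors`
  (`R = 0`), i.e. with `L` replaced by `0`.  Contrapositive: an ODD genus sum forces `rank E_n(ℚ) ≥ 1` — the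
  genus point is a rational point of infinite order up to the twist, with NO appeal to the Gross–Zagier formula
  beyond what the displayed sentences of §3 contain, and no Kolyvagin.
Consumers (doors of `Summits/…/Rank1Residual/P2/`): with `s(n) = 1` from the kernel and an odd genus sum,
`rank E_n(ℚ) = 1 = ord_{s=1} L(E_n, s)`, `Ш(E_n)[2^∞] = 0` and `BSD(E_n, 2)` follow modulo `tyz_genusPointData`
ONLY.

## References
* Y. Tian, X. Yuan, S.-W. Zhang, *Genus periods, genus points and congruent number problem*, Asian J. Math. 21
  (2017) 721–774 = arXiv:1411.4728; §3: Prop. 3.4 (chunk p0011 L76–L89), Thm. 3.5 (p0011 L94–L112),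
  Lemma 3.18, Lemma 3.21, proof of Thm. 3.5 (2) (p0020 L107–L165, p0021 L1–L3). [TianYuanZhang2017]
* J. H. Silverman, AEC, Thm. VIII.6.7 and Ch. VIII intro (rank `0` ⟹ `E(K)` finite). [SilvermanAEC2009]
-/

noncomputable section

open scoped Classical

namespace Literature.NumberTheory.EllipticCurves.TianYuanZhang2017.W2

open _root_.WeierstrassCurve _root_.WeierstrassCurve.Affine
open Literature.NumberTheory.EllipticCurves
open Literature.NumberTheory.EllipticCurves.TianYuanZhang2017

section GPD

variable {n : ℕ}

/-- **The parity engine of Thm. 3.5 (2), abstracted from `uPlus_genusField_of`**: given the displayed data `D`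
and an `E`-side relation `2φ(P(n)) − (ε′L′)R′ ∈ tors` with `N_E R′ = 0`, `R′ = φ(Q₁)` and `L′` EVEN, the genus sums
of the class of `n` are even.  (The W2 proof, from the line `obtain ⟨R', Q₁, ε', …⟩ := main` on, verbatim.)
[cite: TianYuanZhang2017, proof of Thm. 3.5 (2) (chunks p0020 L107–L165, p0021 L1–L3)] -/
theorem even_genusSums_of_relation (D : GenusPointData n) (hsq : Squarefree n)
    (h8 : n % 8 = 5 ∨ n % 8 = 6 ∨ n % 8 = 7)
    (h34 : D.prop34) (h318 : D.lemma318) (hβ : D.betaSpec) (h321 : D.lemma321)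
    {R' : A2Point D.H} {Q₁ : APoint D.H} {ε' L' : ℤ} (hR0 : normE D R' = 0) (hQ₁ : φH D Q₁ = R')
    (hF1E : IsOfFinAddOrder ((2 : ℕ) • φH D (D.P n) - (ε' * L') • R')) (hLe : Even L') :
    ((n % 8 = 5 ∨ n % 8 = 7) → Even (genusSum₁ n gK) ∧ Even (genusSum₂' n gK)) ∧
      (n % 8 = 6 → Even (genusSum₂' n gK)) := by
  obtain ⟨hτ1, hτhalf, hτihalf, hτa0, hτa', hτia0, hτia'⟩ := tau_facts D
  have hτ1ne : (tauOne : APoint D.H) ≠ 0 := Affine.Point.some_ne_zero _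
  have hker : ∀ x, φH D x = 0 → x = 0 ∨ x = tauOne := fun x hx => (φH_eq_zero_iff D x).mp hx
  have hcomm := φH_normA D
  refine ⟨?_, ?_⟩
  · -- classes 5 and 7
    intro h57
    have hodd : Odd n := by rcases h57 with h | h <;> exact Nat.odd_iff.mpr (by omega)
    have htor : ∀ t : APoint D.H, IsOfFinAddOrder t →
        normA D t = (2 : ℕ) • t ∧ (2 : ℕ) • t ∈ AddSubgroup.zmultiples (tauOne : APoint D.H) := by
      intro t ht
      refine ⟨by rw [normA_apply, stub_K4' D h318 hβ hodd t ht, two_nsmul], ?_⟩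
      rcases (h318.1 hodd t ht).2 with h0 | h0
      · rw [h0]; exact zero_mem _
      · rw [h0]; exact AddSubgroup.mem_zmultiples _
    set τa : APoint D.H := if n % 8 = 5 then D.tauHalfOneMinusI else D.iPt D.tauHalfOneMinusI with hτa
    have hτa2 : (2 : ℕ) • τa = 0 := by rw [hτa]; split_ifs <;> assumption
    have hτanot : τa ∉ AddSubgroup.zmultiples (tauOne : APoint D.H) := by
      rw [hτa]; split_ifs <;> assumption
    obtain ⟨a, k, hrel⟩ := stub_K5' D hsq h8 h34 h321 hβ
    rw [bSix_eq_zero_of_odd hodd, cI_eq_zero_of_odd hodd, Nat.cast_zero, zero_smul, zero_smul, add_zero,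
      add_zero] at hrel
    rw [genusSum₂'_eq_brackets, bSix_eq_zero_of_odd hodd, add_zero]
    rcases h57 with h5' | h7'
    · rw [bFiveI_eq_zero_of_five h5', Nat.cast_zero, zero_smul, add_zero] at hrel
      rw [hτa, if_pos h5'] at hτa2 hτanot
      obtain ⟨h5, h7⟩ := W2.Abstract.even_brackets_odd (φH D) hτ1 hτ1ne hker hτa2 hτanot hτhalf
        (normA D) (normE D) hcomm htor hR0 hQ₁ hF1E ⟨a, k, hrel⟩ hLe
      rw [genusSum₁_eq_bFivePlain h5', bFiveI_eq_zero_of_five h5', add_zero]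
      exact ⟨h5, h5.add h7⟩
    · rw [bFivePlain_eq_zero_of_seven h7', Nat.cast_zero, zero_smul, zero_add] at hrel
      rw [hτa, if_neg (show ¬ n % 8 = 5 by omega)] at hτa2 hτanot
      obtain ⟨h5, h7⟩ := W2.Abstract.even_brackets_odd (φH D) hτ1 hτ1ne hker hτa2 hτanot hτhalf
        (normA D) (normE D) hcomm htor hR0 hQ₁ hF1E ⟨a, k, hrel⟩ hLe
      rw [genusSum₁_eq_bSeven h7', bFivePlain_eq_zero_of_seven h7', zero_add]
      exact ⟨h7, h5.add h7⟩
  · -- class 6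
    intro h6
    have heven : Even n := Nat.even_iff.mpr (by omega)
    have htor : ∀ t : APoint D.H, IsOfFinAddOrder t → (4 : ℕ) • t = 0 ∧ (2 : ℕ) • normA D t = 0 := by
      intro t ht
      have h4 := (h318.2 heven).1 t ht
      exact ⟨h4, by rw [normA_apply]; exact (hβ.2.2 heven).1 t h4⟩
    obtain ⟨a, k, hrel⟩ := stub_K5' D hsq h8 h34 h321 hβ
    rw [bFivePlain_eq_zero_of_six h6, bFiveI_eq_zero_of_six h6, Nat.cast_zero, zero_smul, zero_smul,
      zero_add, zero_add] at hrel
    have key := W2.Abstract.even_iff_even_six (φH D) hτ1 hτ1ne hker hτhalf hτihalf hτia0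
      (normA D) (normE D) hcomm htor hR0 hQ₁ hF1E ⟨a, k, hrel⟩ hLe
    rw [genusSum₂'_eq_brackets, bFivePlain_eq_zero_of_six h6, bFiveI_eq_zero_of_six h6, zero_add, zero_add]
    exact Nat.even_add.mpr key

/-- **U⁺ WITHOUT GROSS–ZAGIER–KOLYVAGIN (per `n`, rank bound as a hypothesis).** For square-free
`n ≡ 5, 6, 7 (mod 8)` with `rank E_n(ℚ) ≤ 1` (e.g. from `#Sel⁽²⁾(E_n/ℚ) = 8` by `2`-descent), the displayed §3 data
`tyz_genusPointData` ALONE give an integer `L` with `IsScriptL n L` (`L² = 𝓛(n)²`) such that: if `n ≡ 5, 7` and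
`2 ∣ L` then `Σ₁(n)` and `Σ₂′(n)` (over `GenusField`, `gK`) are even; if `n ≡ 6` and `2 ∣ L` then `Σ₂′(n)` is even.
The proof is `uPlus_genusField_of`'s with its single use of GZK (`rank ≤ 1` from `r_an ≤ 1`) replaced by the
hypothesis `hr`. [cite: TianYuanZhang2017, Thm. 3.5 and its proof (chunks p0011 L94–L112, p0020 L107–L165, p0021 L1–L3)] -/
theorem uPlus_genusField_of_mordellWeilRank_le_one (hTYZ : tyz_genusPointData) (hsq : Squarefree n)
    (h8 : n % 8 = 5 ∨ n % 8 = 6 ∨ n % 8 = 7)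
    (hr : haveI := isElliptic_congruentNumberCurve hsq.ne_zero; (congruentNumberCurve n).mordellWeilRank ≤ 1) :
    ∃ L : ℤ, IsScriptL n L ∧
      ((n % 8 = 5 ∨ n % 8 = 7) → (2 : ℤ) ∣ L → Even (genusSum₁ n gK) ∧ Even (genusSum₂' n gK)) ∧
      (n % 8 = 6 → (2 : ℤ) ∣ L → Even (genusSum₂' n gK)) := by
  letI := isElliptic_congruentNumberCurve hsq.ne_zero
  have hn1 : 1 < n := by rcases h8 with h | h | h <;> omega
  have hn : n ∈ n.divisors := Nat.mem_divisors_self n hsq.ne_zero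
  obtain ⟨D, hLspec, -, -, h34, h35, -, -, -, h318, hβ, h321⟩ := hTYZ n hsq h8
  obtain ⟨ρ, hρ⟩ := stub_S3 hsq
  set L := D.scriptL n with hLdef
  have hL : IsScriptL n L := hLspec n hn hn1
  obtain ⟨ΘA, ΘE, hΘAmem, hΘAsurj, hΘAtor, hΘEminus, hinter, hK2⟩ := stub_twist hsq hn
  -- Steps 1–2: `R′`, `Q₁`, `ε′` with the `E`-side `ρ`-free relation and `N_E R′ = 0`
  have main : ∃ (R' : A2Point D.H) (Q₁ : APoint D.H) (ε' : ℤ),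
      normE D R' = 0 ∧ φH D Q₁ = R' ∧ IsOfFinAddOrder ((2 : ℕ) • φH D (D.P n) - (ε' * L) • R') := by
    by_cases hL0 : L = 0
    · refine ⟨0, 0, 0, map_zero _, map_zero _, ?_⟩
      rw [smul_zero, sub_zero]
      exact ((φH D).isOfFinAddOrder ((h35 hn ρ hρ).1 hL0)).nsmul
    · obtain ⟨R, hR⟩ := stub_S0 hr
      obtain ⟨α₀, hα₀⟩ := stub_S0' hr
      obtain ⟨ε, -, t₂, ht₂, hψα⟩ :=
        stub_S1 hsq (ψQ n) xSqClass_eq_one_iff_exists_ψQ hρ hR hα₀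
      obtain ⟨s, -, hF1⟩ := (h35 hn ρ hρ).2 hL0 (ΘA α₀) (generatesFreePart_of_twist ΘA hΘAmem hΘAsurj hα₀)
      have hF1E := step1E_fixed D hn ΘA ΘE hinter hF1 ht₂ hψα
      obtain ⟨Q₁, hQ₁⟩ := hK2 D R
      exact ⟨_, Q₁, s * ε, normE_map_embK D hn hβ (ΘE R) (hΘEminus R), hQ₁, hF1E⟩
  obtain ⟨R', Q₁, ε', hR0, hQ₁, hF1E⟩ := main
  refine ⟨L, hL, ?_, ?_⟩
  · intro h57 h2L
    exact (even_genusSums_of_relation D hsq h8 h34 h318 hβ h321 hR0 hQ₁ hF1E (even_iff_two_dvd.mpr h2L)).1 h57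
  · intro h6 h2L
    exact (even_genusSums_of_relation D hsq h8 h34 h318 hβ h321 hR0 hQ₁ hF1E (even_iff_two_dvd.mpr h2L)).2 h6

/-- **RANK ZERO SILENCES THE GENUS SUMS (modulo `tyz_genusPointData` alone).** For square-free
`n ≡ 5, 6, 7 (mod 8)` with `rank E_n(ℚ) = 0`: if `n ≡ 5, 7` then `Σ₁(n)` and `Σ₂′(n)` are even; if `n ≡ 6` then
`Σ₂′(n)` is even.  Proof: `A_n(ℚ)` is finite (isogeny + Mordell–Weil), so `α_n = 0` generates its free part and
Thm. 3.5's main clause makes `P(n)` torsion (directly if `𝓛(n) = 0`, else via «`2^{1+ρ}P(n) − s𝓛α_n` torsion»);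
then the proof of Thm. 3.5 (2) runs with `R = 0`, `L = 0`.  Contrapositive — the form the doors use: an ODD genus
sum forces `rank E_n(ℚ) ≠ 0`, with no Gross–Zagier–Kolyvagin input.
[cite: TianYuanZhang2017, Thm. 3.5 (main clause, p0011 L27–L36, L94–L95) and proof of Thm. 3.5 (2) (p0020 L107–L165)]
[cite: SilvermanAEC2009, Thm. VIII.6.7 and Ch. VIII intro] -/
theorem even_genusSums_of_mordellWeilRank_eq_zero (hTYZ : tyz_genusPointData) (hsq : Squarefree n)
    (h8 : n % 8 = 5 ∨ n % 8 = 6 ∨ n % 8 = 7)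
    (hr0 : haveI := isElliptic_congruentNumberCurve hsq.ne_zero; (congruentNumberCurve n).mordellWeilRank = 0) :
    ((n % 8 = 5 ∨ n % 8 = 7) →
        Even (genusSum₁ n gK) ∧ Even (genusSum₂' n gK)) ∧
      (n % 8 = 6 → Even (genusSum₂' n gK)) := by
  letI := isElliptic_congruentNumberCurve hsq.ne_zero
  have hn1 : 1 < n := by rcases h8 with h | h | h <;> omega
  have hn : n ∈ n.divisors := Nat.mem_divisors_self n hsq.ne_zero
  obtain ⟨D, hLspec, -, -, h34, h35, -, -, -, h318, hβ, h321⟩ := hTYZ n hsq h8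
  obtain ⟨ρ, hρ⟩ := stub_S3 hsq
  set L := D.scriptL n with hLdef
  obtain ⟨ΘA, ΘE, hΘAmem, hΘAsurj, -, -, -, -⟩ := stub_twist hsq hn
  -- the genus point is torsion
  have hPtor : IsOfFinAddOrder (D.P n) := by
    by_cases hL0 : L = 0
    · exact (h35 hn ρ hρ).1 hL0
    · -- `A_n(ℚ)` is finite: `α₀ = 0` generates the free part
      have hrA : (congruentNumberCurve n).twoIsogenyCodomain.mordellWeilRank = 0 := by
        rw [← (congruentNumberCurve n).twoIsogeny.mordellWeilRank_eq]; exact hr0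
      haveI : Finite (congruentNumberCurve n).twoIsogenyCodomain.toAffine.Point :=
        finite_point_of_rank_zero _ hrA
      have hα₀ : ∀ x : (congruentNumberCurve n).twoIsogenyCodomain.toAffine.Point,
          ∃ k : ℤ, IsOfFinAddOrder (x - k • (0 : (congruentNumberCurve n).twoIsogenyCodomain.toAffine.Point)) :=
        fun x => ⟨0, by simpa using isOfFinAddOrder_of_finite x⟩
      obtain ⟨s, -, hF1⟩ := (h35 hn ρ hρ).2 hL0 (ΘA 0) (generatesFreePart_of_twist ΘA hΘAmem hΘAsurj hα₀)
      rw [map_zero, Affine.Point.map_zero, smul_zero, sub_zero] at hF1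
      have hF1' : IsOfFinAddOrder ((2 ^ (ρ + 1) : ℕ) • D.P n) := by
        rwa [← natCast_zsmul, Nat.cast_pow, Nat.cast_ofNat]
      exact W2.Abstract.isOfFinAddOrder_of_nsmul (pow_ne_zero _ two_ne_zero) hF1'
  -- run the parity engine with `R′ = 0`, `L′ = 0`
  have hF1E : IsOfFinAddOrder ((2 : ℕ) • φH D (D.P n) - ((0 : ℤ) * (0 : ℤ)) • (0 : A2Point D.H)) := by
    rw [smul_zero, sub_zero]
    exact ((φH D).isOfFinAddOrder hPtor).nsmul
  exact even_genusSums_of_relation D hsq h8 h34 h318 hβ h321 (map_zero _) (map_zero _) hF1E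
    (by exact ⟨0, rfl⟩)

end GPD

end Literature.NumberTheory.EllipticCurves.TianYuanZhang2017.W2

end
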